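import Summits.BirchSwinnertonDyer.BirchSwinnertonDyer.Theorems.ManinLocalTwoThreeCDivisionPoleKill
import Summits.BirchSwinnertonDyer.BirchSwinnertonDyer.Theorems.ManinLocalTwoThreeIntegralCuspPresentation
import Summits.BirchSwinnertonDyer.Rank1Residual.ManinAdditive.KummerCubeMonodromy
import Literature.NumberTheory.EllipticCurves.ModularCurveManinSemistableProofs
import HarnessLib

/-!
# The `c`-division witness: an g44's nodes (N1)–(N5) DISCHARGED in their typed shapes

Cell `bsd-f2-manin`, prover seat p2 (gen 20); crux C2 `ManinOddAtFour` (stmt-BirchSwinnertonDyer-22967) and C3 `ManinPrimeToThreeAtNine`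
(stmt-22968).  The planner seat an g44 typed the `c`-DIVISION WITNESS `F = 12·℘_{Λ_W}(E_f)·B_d·Δ^a` as seven `Prop` nodes (N1)–(N7) with a PROVED
composition `cDivisionWitnessLaw_of_nodes` (HOME/an/g44/CDivisionWitnessNodes-an-g44.lean, not yet in the tree).  This file proves (N1)–(N5) with
EXACTLY the node bodies as statements (so that `theorem … : CDivXPresentation := cDivXPresentation_holds` etc. are one-liners once the node file lands),
from the landed `…CDivisionPoleKill` (N1 integer presentation, N2 order bookkeeping, N3 extension pattern, N5 Manin's lemma):

* `cDivXPresentation_holds` (N1) — `∃ w Bn Bd bd, Bd ≠ 0 ∧ (Bd has the integer q-series Σ bd n qⁿ on ℍ) ∧ (c·E_f τ ∉ Λ_W → Bd τ·shortX D τ = Bn τ)`;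
* `cDivPoleKill_holds` (N2) — such a presentation kills the poles of `℘_{Λ_W}(E_f)·(12·Bd·Δ^a)`;
* `cDivExtension_holds` (N3) — holomorphic extension `F` of `℘_{Λ_W}(E_f)·(12·Bd·Δ^a)` across the poles;
* `cDivInvariance_holds` (N4) — `{∞, γ∞}_f ∈ Λ_W ⟹ F ∣[w + 12a] γ = F` (ANY integer weight `w`; identity theorem off the countable pole set);
* `cDivStabiliser_holds` (N5) — `F ∣[w + 12a] γ = F ⟹ {∞, γ∞}_f ∈ Λ_W` (`Bd ≠ 0`).

Everything is proved (standard axioms); no named fact.  BSD is not proved by this file; C2/C3 are not proved by this file ((N6), (N7), CDT and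
E-an-152b remain).
-/

set_option linter.dupNamespace false
set_option autoImplicit false

noncomputable section

open Complex Filter Topology Set Function
open UpperHalfPlane hiding I
open scoped Real Topology Manifold MatrixGroups PeriodPair ModularForm
open ModularForm SlashInvariantForm ModularFormClass CongruenceSubgroup

open Literature.NumberTheory.EllipticCurves Literature.NumberTheory.EllipticCurves.ModularForms
open Summit.BirchSwinnertonDyer.Rank1Residual.ManinAdditive.KummerCubeMonodromy

namespace Summit.BirchSwinnertonDyer.BirchSwinnertonDyer.Theorems.ManinLocalTwoThree.CDivision

variable {N : ℕ} [NeZero N]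

/-! ### `shortX` is `℘_{c⁻¹Λ_W}(E_f)` -/

/-- `℘_{c⁻¹Λ_W}(E_f(τ)) = c²·℘_{Λ_W}(c·E_f(τ)) = shortX D τ`. [folklore] -/
theorem weierstrassP_mulLeft_inv_eichlerIntegral {W : WeierstrassCurve ℚ} (D : ModularParametrizationData W N)
    (hc : (D.c : ℂ) ≠ 0) (τ : ℍ) :
    ℘[D.L.mulLeft ((D.c : ℂ)⁻¹) (inv_ne_zero hc)] (eichlerIntegral D.f τ) = shortX D τ := by
  have h := PeriodPair.weierstrassP_mulLeft ((D.c : ℂ)⁻¹) (inv_ne_zero hc) D.L ((D.c : ℂ) * eichlerIntegral D.f τ)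
  rw [inv_mul_cancel_left₀ hc, inv_pow, inv_inv] at h
  rw [h, shortX]

/-- `u ∈ c⁻¹Λ_W ↔ c·u ∈ Λ_W`. [folklore] -/
theorem mem_mulLeft_inv_iff {W : WeierstrassCurve ℚ} (D : ModularParametrizationData W N) (hc : (D.c : ℂ) ≠ 0) (x : ℂ) :
    x ∈ (D.L.mulLeft ((D.c : ℂ)⁻¹) (inv_ne_zero hc)).lattice ↔ (D.c : ℂ) * x ∈ D.L.lattice := by
  rw [PeriodPair.mem_mulLeft_lattice, inv_inv]

/-- A `shortX`-presentation `Bd·shortX = Bn` (off `c·E_f ∈ Λ_W`) is a presentation of `℘_{c⁻¹Λ_W}(E_f)` off its poles. [folklore] -/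
theorem presentation_of_shortX {W : WeierstrassCurve ℚ} (D : ModularParametrizationData W N) (hc : (D.c : ℂ) ≠ 0)
    {Bn Bd : ℍ → ℂ} (h : ∀ τ : ℍ, (D.c : ℂ) * eichlerIntegral D.f τ ∉ D.L.lattice → Bd τ * shortX D τ = Bn τ) (τ : ℍ)
    (hτ : eichlerIntegral D.f τ ∉ (D.L.mulLeft ((D.c : ℂ)⁻¹) (inv_ne_zero hc)).lattice) :
    ℘[D.L.mulLeft ((D.c : ℂ)⁻¹) (inv_ne_zero hc)] (eichlerIntegral D.f τ) * Bd τ = Bn τ := by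
  rw [weierstrassP_mulLeft_inv_eichlerIntegral D hc, mul_comm]
  exact h τ ((mem_mulLeft_inv_iff D hc _).not.mp hτ)

/-! ### (N1) -/

/-- **(N1) `CDivXPresentation`.** [cite: ShimuraIATAF1971, Thm. 3.52 and Thm. 7.14] -/
theorem cDivXPresentation_holds :
    ∀ (W : WeierstrassCurve ℚ) [W.IsElliptic] [W.IsGloballyMinimal] {N : ℕ} [NeZero N] (D : ModularParametrizationData W N),
    ∃ (w : ℤ) (Bn Bd : ModularForm (Gamma0 N) w) (bd : ℕ → ℤ), Bd ≠ 0 ∧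
      (∀ τ : ℍ, HasSum (fun n : ℕ ↦ (bd n : ℂ) * Complex.exp (2 * Real.pi * Complex.I * (τ : ℂ) * n)) (Bd τ)) ∧
      ∀ τ : ℍ, (D.c : ℂ) * eichlerIntegral D.f τ ∉ D.L.lattice → Bd τ * shortX D τ = Bn τ := by
  intro W _ _ N _ D
  have hc : (D.c : ℂ) ≠ 0 := D.cast_c_ne_zero
  obtain ⟨k, F, G, -, hX, hint⟩ := exists_int_isXPresentation D hc
  choose bd hbd using hint
  refine ⟨k, (F : ModularForm (Gamma0 N) k), (G : ModularForm (Gamma0 N) k), bd, hX.modularForm_ne_zero,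
    fun τ ↦ ParamPoleJ.hasSum_int_qExpansion (G : ModularForm (Gamma0 N) k) bd (fun m ↦ hbd m) τ, fun τ hτ ↦ ?_⟩
  have hτ' : eichlerIntegral D.f τ ∉ (D.L.mulLeft ((D.c : ℂ)⁻¹) (inv_ne_zero hc)).lattice :=
    (mem_mulLeft_inv_iff D hc _).not.mpr hτ
  have h := hX.2 τ hτ'
  rw [weierstrassP_mulLeft_inv_eichlerIntegral D hc] at h
  rw [mul_comm]
  exact h

/-! ### (N2) -/

/-- Order bookkeeping with raw holomorphic numerator/denominator: if `℘_{L′}(E_f)·G = Fn` off the poles of `℘_{L′}(E_f)` with `G, Fn`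
holomorphic on `ℍ` and `Λ(L) ⊆ Λ(L′)`, then at a pole `z` of `℘_L(E_f)`, `0 ≤ ord_z(℘_L(E_f)·G)`. [folklore] -/
theorem meromorphicOrderAt_weierstrassP_mul_nonneg_of_eq (f : CuspForm (Gamma0 N) 2) (hf : f ≠ 0)
    {L L' : PeriodPair} (hLL' : ∀ z ∈ L.lattice, z ∈ L'.lattice) {Fn G : ℍ → ℂ}
    (hG : MDifferentiable 𝓘(ℂ) 𝓘(ℂ) G) (hFn : MDifferentiable 𝓘(ℂ) 𝓘(ℂ) Fn)
    (hpres : ∀ τ : ℍ, eichlerIntegral f τ ∉ L'.lattice → ℘[L'] (eichlerIntegral f τ) * G τ = Fn τ)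
    {z : ℂ} (hz : 0 < z.im) (hzL : eichlerIntegral f (ofComplex z) ∈ L.lattice) :
    0 ≤ meromorphicOrderAt ((fun w : ℂ ↦ ℘[L] (eichlerIntegral f (ofComplex w))) * (G ∘ ofComplex)) z := by
  have hzL' : eichlerIntegral f (ofComplex z) ∈ L'.lattice := hLL' _ hzL
  have hordL := meromorphicOrderAt_weierstrassP_eichlerIntegral f hf L hz hzL
  have hordL' := meromorphicOrderAt_weierstrassP_eichlerIntegral f hf L' hz hzL'
  have hGan : AnalyticAt ℂ (G ∘ ofComplex) z :=
    (UpperHalfPlane.mdifferentiable_iff.mp hG).analyticAt (isOpen_upperHalfPlaneSet.mem_nhds hz)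
  have hFan : AnalyticAt ℂ (Fn ∘ ofComplex) z :=
    (UpperHalfPlane.mdifferentiable_iff.mp hFn).analyticAt (isOpen_upperHalfPlaneSet.mem_nhds hz)
  have hXm : MeromorphicAt (fun w : ℂ ↦ ℘[L] (eichlerIntegral f (ofComplex w))) z :=
    meromorphicAt_weierstrassP_eichlerIntegral f L hz
  have hXm' : MeromorphicAt (fun w : ℂ ↦ ℘[L'] (eichlerIntegral f (ofComplex w))) z :=
    meromorphicAt_weierstrassP_eichlerIntegral f L' hz
  rw [meromorphicOrderAt_mul hXm hGan.meromorphicAt, hordL, ← hordL', ← meromorphicOrderAt_mul hXm' hGan.meromorphicAt]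
  have hev : ((fun w : ℂ ↦ ℘[L'] (eichlerIntegral f (ofComplex w))) * (G ∘ ofComplex)) =ᶠ[𝓝[≠] z] (Fn ∘ ofComplex) := by
    filter_upwards [eventually_nhdsNE_eichlerIntegral_notMem f hf L' hz] with w hw
    simp only [Pi.mul_apply, comp_apply]
    exact hpres (ofComplex w) hw.2
  rw [meromorphicOrderAt_congr hev]
  exact hFan.meromorphicOrderAt_nonneg

omit [NeZero N] in
/-- `12·Bd·Δ^a ∘ ofComplex` is analytic on the half-plane, for `Bd` holomorphic on `ℍ`. [folklore] -/
theorem analyticOnNhd_twelve_mul_mul_discriminant_pow' {Bd : ℍ → ℂ} (hBd : MDifferentiable 𝓘(ℂ) 𝓘(ℂ) Bd) (a : ℕ) :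
    AnalyticOnNhd ℂ ((fun τ : ℍ ↦ (12 : ℂ) * Bd τ * ModularForm.discriminant τ ^ a) ∘ ofComplex) {z : ℂ | 0 < z.im} := by
  intro z hz
  have hG : AnalyticAt ℂ (Bd ∘ ofComplex) z :=
    (UpperHalfPlane.mdifferentiable_iff.mp hBd).analyticAt (isOpen_upperHalfPlaneSet.mem_nhds hz)
  have hΔ : AnalyticAt ℂ (ModularForm.discriminant ∘ ofComplex) z := analyticOnNhd_discriminant_comp_ofComplex z hz
  have h : AnalyticAt ℂ (fun w : ℂ ↦ (12 : ℂ) * (Bd ∘ ofComplex) w * (ModularForm.discriminant ∘ ofComplex) w ^ a) z :=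
    (analyticAt_const.mul hG).mul (hΔ.pow a)
  exact h

/-- (N2) for the datum and any holomorphic `shortX`-presentation: the denominator kills the poles of `℘_{Λ_W}(E_f)·(12·Bd·Δ^a)`. [folklore] -/
theorem cDivPoleKill_of_presentation {W : WeierstrassCurve ℚ} (D : ModularParametrizationData W N) {Bn Bd : ℍ → ℂ}
    (hBd : MDifferentiable 𝓘(ℂ) 𝓘(ℂ) Bd) (hBn : MDifferentiable 𝓘(ℂ) 𝓘(ℂ) Bn)
    (hpres : ∀ τ : ℍ, (D.c : ℂ) * eichlerIntegral D.f τ ∉ D.L.lattice → Bd τ * shortX D τ = Bn τ) (a : ℕ) (z : ℂ)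
    (hz : 0 < z.im) (hzL : eichlerIntegral D.f (ofComplex z) ∈ D.L.lattice) :
    0 ≤ meromorphicOrderAt ((fun u : ℂ ↦ ℘[D.L] (eichlerIntegral D.f (ofComplex u))) *
      ((fun τ : ℍ ↦ (12 : ℂ) * Bd τ * ModularForm.discriminant τ ^ a) ∘ ofComplex)) z := by
  have hc : (D.c : ℂ) ≠ 0 := D.cast_c_ne_zero
  have hf : D.f ≠ 0 := D.isNewformOf.1.ne_zero
  have hΔan : AnalyticAt ℂ (fun w : ℂ ↦ (12 : ℂ) * (ModularForm.discriminant ∘ ofComplex) w ^ a) z :=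
    analyticAt_const.mul ((analyticOnNhd_discriminant_comp_ofComplex z hz).pow a)
  have hBdan : AnalyticAt ℂ (Bd ∘ ofComplex) z :=
    (UpperHalfPlane.mdifferentiable_iff.mp hBd).analyticAt (isOpen_upperHalfPlaneSet.mem_nhds hz)
  have hXm : MeromorphicAt (fun w : ℂ ↦ ℘[D.L] (eichlerIntegral D.f (ofComplex w))) z :=
    meromorphicAt_weierstrassP_eichlerIntegral D.f D.L hz
  have hsplit : ((fun u : ℂ ↦ ℘[D.L] (eichlerIntegral D.f (ofComplex u))) *
      ((fun τ : ℍ ↦ (12 : ℂ) * Bd τ * ModularForm.discriminant τ ^ a) ∘ ofComplex)) =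
      ((fun u : ℂ ↦ ℘[D.L] (eichlerIntegral D.f (ofComplex u))) * (Bd ∘ ofComplex)) *
        fun w : ℂ ↦ (12 : ℂ) * (ModularForm.discriminant ∘ ofComplex) w ^ a := by
    funext w
    simp only [Pi.mul_apply, comp_apply]
    ring
  rw [hsplit, meromorphicOrderAt_mul (hXm.mul hBdan.meromorphicAt) hΔan.meromorphicAt]
  refine add_nonneg ?_ hΔan.meromorphicOrderAt_nonneg
  exact meromorphicOrderAt_weierstrassP_mul_nonneg_of_eq D.f hf (lattice_le_mulLeft_inv D hc) hBd hBn
    (presentation_of_shortX D hc hpres) hz hzL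

/-- **(N2) `CDivPoleKill`.** [folklore] -/
theorem cDivPoleKill_holds :
    ∀ (W : WeierstrassCurve ℚ) [W.IsElliptic] [W.IsGloballyMinimal] {N : ℕ} [NeZero N] (D : ModularParametrizationData W N)
      (w : ℤ) (Bn Bd : ModularForm (Gamma0 N) w),
    (∀ τ : ℍ, (D.c : ℂ) * eichlerIntegral D.f τ ∉ D.L.lattice → Bd τ * shortX D τ = Bn τ) →
    ∀ (a : ℕ) (z : ℂ), 0 < z.im → eichlerIntegral D.f (ofComplex z) ∈ D.L.lattice →
      0 ≤ meromorphicOrderAt ((fun u : ℂ ↦ ℘[D.L] (eichlerIntegral D.f (ofComplex u))) *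
        ((fun τ : ℍ ↦ (12 : ℂ) * Bd τ * ModularForm.discriminant τ ^ a) ∘ ofComplex)) z := by
  intro W _ _ N _ D w Bn Bd hpres a z hz hzL
  exact cDivPoleKill_of_presentation D Bd.holo' Bn.holo' hpres a z hz hzL

/-! ### (N3) holomorphic extension -/

/-- **Removable singularities.**  For `G` analytic on the half-plane killing the poles of `℘_Λ(E_f)`, the meromorphic normal form `F` of
`℘_Λ(E_f)·G` is holomorphic on `ℍ` and equals `℘_Λ(E_f)·G` off the poles (no invariance claimed). [folklore] -/
theorem exists_holomorphic_extension (f : CuspForm (Gamma0 N) 2) (L : PeriodPair) (G : ℍ → ℂ)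
    (hGan : AnalyticOnNhd ℂ (G ∘ ofComplex) {z : ℂ | 0 < z.im})
    (hkill : ∀ z : ℂ, 0 < z.im → eichlerIntegral f (ofComplex z) ∈ L.lattice →
      0 ≤ meromorphicOrderAt ((fun w : ℂ ↦ ℘[L] (eichlerIntegral f (ofComplex w))) * (G ∘ ofComplex)) z) :
    ∃ F : ℍ → ℂ, MDifferentiable 𝓘(ℂ) 𝓘(ℂ) F ∧
      ∀ τ : ℍ, eichlerIntegral f τ ∉ L.lattice → ℘[L] (eichlerIntegral f τ) * G τ = F τ := by
  set U : ℂ → ℂ := fun w ↦ eichlerIntegral f (ofComplex w) with hU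
  set X : ℂ → ℂ := fun w ↦ ℘[L] (eichlerIntegral f (ofComplex w)) with hX
  set Gc : ℂ → ℂ := G ∘ ofComplex with hGc
  set H : Set ℂ := {z : ℂ | 0 < z.im} with hH
  have hXm : ∀ z ∈ H, MeromorphicAt X z := fun z hz ↦ meromorphicAt_weierstrassP_eichlerIntegral f L hz
  have hXG : MeromorphicOn (X * Gc) H := fun z hz ↦ (hXm z hz).mul (hGan z hz).meromorphicAt
  have hXan : ∀ z ∈ H, U z ∉ L.lattice → AnalyticAt ℂ X z := fun z hz hzL ↦
    analyticOnNhd_weierstrassP_eichlerIntegral f L z ⟨hz, hzL⟩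
  have hord : ∀ z ∈ H, 0 ≤ meromorphicOrderAt (X * Gc) z := by
    intro z hz
    by_cases hzL : U z ∈ L.lattice
    · exact hkill z hz hzL
    · exact meromorphicOrderAt_mul_nonneg_of_analyticAt (hXan z hz hzL) (hGan z hz)
  set Fc : ℂ → ℂ := toMeromorphicNFOn (X * Gc) H with hFc
  have hFan : AnalyticOnNhd ℂ Fc H := fun z hz ↦ analyticAt_toMeromorphicNFOn hXG hz (hord z hz)
  have hFeq : ∀ z ∈ H, U z ∉ L.lattice → Fc z = X z * Gc z := fun z hz hzL ↦
    toMeromorphicNFOn_apply_of_analyticAt hXG hz ((hXan z hz hzL).mul (hGan z hz))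
  refine ⟨fun τ : ℍ ↦ Fc τ, ?_, ?_⟩
  · rw [UpperHalfPlane.mdifferentiable_iff]
    refine hFan.differentiableOn.congr fun z hz ↦ ?_
    simp only [comp_apply, ofComplex_apply_of_im_pos hz, UpperHalfPlane.coe_mk]
  · intro τ hτ
    show ℘[L] (eichlerIntegral f τ) * G τ = Fc τ
    have := hFeq τ τ.im_pos (by simpa [hU, ofComplex_apply] using hτ)
    rw [this]
    simp [hX, hGc, ofComplex_apply]

/-- **(N3) `CDivExtension`.** [folklore] -/
theorem cDivExtension_holds :
    ∀ (W : WeierstrassCurve ℚ) [W.IsElliptic] [W.IsGloballyMinimal] {N : ℕ} [NeZero N] (D : ModularParametrizationData W N)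
      (w : ℤ) (Bd : ModularForm (Gamma0 N) w) (a : ℕ),
    (∀ z : ℂ, 0 < z.im → eichlerIntegral D.f (ofComplex z) ∈ D.L.lattice →
      0 ≤ meromorphicOrderAt ((fun u : ℂ ↦ ℘[D.L] (eichlerIntegral D.f (ofComplex u))) *
        ((fun τ : ℍ ↦ (12 : ℂ) * Bd τ * ModularForm.discriminant τ ^ a) ∘ ofComplex)) z) →
    ∃ F : ℍ → ℂ, MDifferentiable 𝓘(ℂ) 𝓘(ℂ) F ∧
      ∀ τ : ℍ, eichlerIntegral D.f τ ∉ D.L.lattice →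
        F τ = ℘[D.L] (eichlerIntegral D.f τ) * ((12 : ℂ) * Bd τ * ModularForm.discriminant τ ^ a) := by
  intro W _ _ N _ D w Bd a hkill
  obtain ⟨F, hF, hFeq⟩ := exists_holomorphic_extension D.f D.L (fun τ : ℍ ↦ (12 : ℂ) * Bd τ * ModularForm.discriminant τ ^ a)
    (analyticOnNhd_twelve_mul_mul_discriminant_pow' Bd.holo' a) hkill
  exact ⟨F, hF, fun τ hτ ↦ (hFeq τ hτ).symm⟩

/-! ### (N4) invariance under the stabiliser -/

/-- Two holomorphic functions on `ℍ` that agree off the (countable) pole set `{E_f ∈ Λ}` are equal (`f ≠ 0`; identity theorem on the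
connected half-plane). [folklore] -/
theorem eq_of_eqOn_off_poles (f : CuspForm (Gamma0 N) 2) (hf : f ≠ 0) (L : PeriodPair) {A B : ℍ → ℂ}
    (hA : MDifferentiable 𝓘(ℂ) 𝓘(ℂ) A) (hB : MDifferentiable 𝓘(ℂ) 𝓘(ℂ) B)
    (h : ∀ τ : ℍ, eichlerIntegral f τ ∉ L.lattice → A τ = B τ) : A = B := by
  set H : Set ℂ := {z : ℂ | 0 < z.im} with hH
  have hAan : AnalyticOnNhd ℂ (A ∘ ofComplex) H := (UpperHalfPlane.mdifferentiable_iff.mp hA).analyticOnNhd isOpen_upperHalfPlaneSet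
  have hBan : AnalyticOnNhd ℂ (B ∘ ofComplex) H := (UpperHalfPlane.mdifferentiable_iff.mp hB).analyticOnNhd isOpen_upperHalfPlaneSet
  obtain ⟨z₀, hz₀⟩ := nonempty_diff_of_countable (countable_setOf_eichlerIntegral_mem_lattice f L hf)
  have hz₀H : z₀ ∈ H := hz₀.1
  have hz₀L : eichlerIntegral f (ofComplex z₀) ∉ L.lattice := fun h' ↦ hz₀.2 ⟨hz₀.1, h'⟩
  have hev : (A ∘ ofComplex) =ᶠ[𝓝 z₀] (B ∘ ofComplex) := by
    filter_upwards [(isOpen_setOf_eichlerIntegral_notMem_lattice f L).mem_nhds ⟨hz₀H, hz₀L⟩] with z hz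
    exact h (ofComplex z) hz.2
  have heq := hAan.eqOn_of_preconnected_of_eventuallyEq hBan convex_setOf_im_pos.isPreconnected hz₀H hev
  funext τ
  have := heq τ.im_pos
  simpa [ofComplex_apply] using this

/-- `F ∣[w + 12a] γ = F` for `{∞, γ∞}_f ∈ Λ`, for ANY holomorphic `F` equal to `℘_Λ(E_f)·(12·Bd·Δ^a)` off the poles, `Bd ∈ M_w(Γ₀(N))`:
off the poles `℘_Λ(E_f(γτ)) = ℘_Λ(E_f(τ))` and `(12BdΔ^a)(γτ) = (cτ+d)^{w+12a}(12BdΔ^a)(τ)`; everywhere by `eq_of_eqOn_off_poles`. [folklore] -/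
theorem slash_eq_of_cuspSymbol_mem {W : WeierstrassCurve ℚ} (D : ModularParametrizationData W N) {w : ℤ}
    (Bd : ModularForm (Gamma0 N) w) (a : ℕ) (F : ℍ → ℂ) (hF : MDifferentiable 𝓘(ℂ) 𝓘(ℂ) F)
    (hFeq : ∀ τ : ℍ, eichlerIntegral D.f τ ∉ D.L.lattice →
      F τ = ℘[D.L] (eichlerIntegral D.f τ) * ((12 : ℂ) * Bd τ * ModularForm.discriminant τ ^ a))
    (γ : Gamma0 N) (hγ : cuspSymbol D.f γ ∈ D.L.lattice) : F ∣[w + 12 * (a : ℤ)] (γ : SL(2, ℤ)) = F := by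
  have hf : D.f ≠ 0 := D.isNewformOf.1.ne_zero
  refine eq_of_eqOn_off_poles D.f hf D.L (hF.slash _ _) hF fun τ hτ ↦ ?_
  have hτ' : eichlerIntegral D.f ((γ : SL(2, ℤ)) • τ) ∉ D.L.lattice :=
    fun h ↦ hτ ((eichlerIntegral_gamma_smul_mem_iff_of_cuspSymbol_mem D.f D.L γ hγ τ).mp h)
  have hd0 : denom (γ : SL(2, ℤ)) τ ≠ 0 := denom_ne_zero (γ : SL(2, ℤ)) τ
  rw [ModularForm.SL_slash_apply, hFeq _ hτ', hFeq _ hτ, weierstrassP_eichlerIntegral_gamma_smul_of_cuspSymbol_mem D.f D.L γ hγ τ,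
    SlashInvariantForm.slash_action_eqn_SL'' Bd γ.2 τ, discriminant_apply_smul (γ : SL(2, ℤ)) τ, mul_pow,
    ← zpow_natCast (denom (γ : SL(2, ℤ)) τ ^ (12 : ℤ)) a, ← zpow_mul, zpow_neg, zpow_add₀ hd0]
  have h1 : denom (γ : SL(2, ℤ)) τ ^ w ≠ 0 := zpow_ne_zero _ hd0
  have h2 : denom (γ : SL(2, ℤ)) τ ^ ((12 : ℤ) * (a : ℤ)) ≠ 0 := zpow_ne_zero _ hd0
  field_simp

/-- **(N4) `CDivInvariance`.** [folklore] -/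
theorem cDivInvariance_holds :
    ∀ (W : WeierstrassCurve ℚ) [W.IsElliptic] [W.IsGloballyMinimal] {N : ℕ} [NeZero N] (D : ModularParametrizationData W N)
      (w : ℤ) (Bd : ModularForm (Gamma0 N) w) (a : ℕ) (F : ℍ → ℂ), MDifferentiable 𝓘(ℂ) 𝓘(ℂ) F →
    (∀ τ : ℍ, eichlerIntegral D.f τ ∉ D.L.lattice →
      F τ = ℘[D.L] (eichlerIntegral D.f τ) * ((12 : ℂ) * Bd τ * ModularForm.discriminant τ ^ a)) →
    ∀ γ : Gamma0 N, cuspSymbol D.f γ ∈ D.L.lattice → F ∣[w + 12 * (a : ℤ)] (γ : SL(2, ℤ)) = F := by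
  intro W _ _ N _ D w Bd a F hF hFeq γ hγ
  exact slash_eq_of_cuspSymbol_mem D Bd a F hF hFeq γ hγ

/-! ### (N5) the exact stabiliser -/

/-- **Manin's lemma, integer weight.**  `f ≠ 0`, `G : ℍ → ℂ` holomorphic, `G(τ₁) ≠ 0` somewhere, `G(γτ) = (cτ+d)^K G(τ)` (`K : ℤ`) for ONE
`γ ∈ Γ₀(N)`, `F = ℘_Λ(E_f)·G` off the poles; if `F ∣[K] γ = F` then `{∞, γ∞}_f ∈ Λ` (`PeriodPair.mem_lattice_of_weierstrassP_comp_add_eventuallyEq`).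
[cite: Manin1972, Prop. 1.4] -/
theorem cuspSymbol_mem_of_slash_eq_zpow (f : CuspForm (Gamma0 N) 2) (hf : f ≠ 0) (L : PeriodPair) (G F : ℍ → ℂ) (K : ℤ)
    (hGmd : MDifferentiable 𝓘(ℂ) 𝓘(ℂ) G) (hG1 : ∃ τ₁ : ℍ, G τ₁ ≠ 0) (γ : Gamma0 N)
    (hGsmul : ∀ τ : ℍ, G ((γ : SL(2, ℤ)) • τ) = denom (γ : SL(2, ℤ)) τ ^ K * G τ)
    (hFG : ∀ τ : ℍ, eichlerIntegral f τ ∉ L.lattice → ℘[L] (eichlerIntegral f τ) * G τ = F τ)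
    (hγ : F ∣[K] (γ : SL(2, ℤ)) = F) : cuspSymbol f γ ∈ L.lattice := by
  set s : ℂ := cuspSymbol f γ with hs
  set U : ℂ → ℂ := fun w ↦ eichlerIntegral f (ofComplex w) with hU
  set Gc : ℂ → ℂ := G ∘ ofComplex with hGc
  have hUc : ContinuousOn U {z : ℂ | 0 < z.im} := (differentiableOn_eichlerIntegral_comp_ofComplex f).continuousOn
  have hGc' : ContinuousOn Gc {z : ℂ | 0 < z.im} := (UpperHalfPlane.mdifferentiable_iff.mp hGmd).continuousOn
  -- the pointwise identity off poles and zeros of `G`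
  have hpt : ∀ τ : ℍ, eichlerIntegral f τ ∉ L.lattice → s + eichlerIntegral f τ ∉ L.lattice → G τ ≠ 0 →
      ℘[L] (s + eichlerIntegral f τ) = ℘[L] (eichlerIntegral f τ) := by
    intro τ h1 h2 hG
    have h := congr_fun hγ τ
    rw [ModularForm.SL_slash_apply] at h
    have h2' : eichlerIntegral f ((γ : SL(2, ℤ)) • τ) ∉ L.lattice := by
      rw [eichlerIntegral_gamma_smul_eq_add, add_comm]; exact h2
    rw [← hFG _ h2', ← hFG _ h1, hGsmul τ, eichlerIntegral_gamma_smul_eq_add, add_comm _ s] at h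
    have hd0 : denom (γ : SL(2, ℤ)) τ ≠ 0 := denom_ne_zero (γ : SL(2, ℤ)) τ
    have hdK : denom (γ : SL(2, ℤ)) τ ^ K ≠ 0 := zpow_ne_zero _ hd0
    have h' : ℘[L] (s + eichlerIntegral f τ) * G τ = ℘[L] (eichlerIntegral f τ) * G τ := by
      have : ℘[L] (s + eichlerIntegral f τ) * (denom (γ : SL(2, ℤ)) τ ^ K * G τ) *
          denom (γ : SL(2, ℤ)) τ ^ (-K) = ℘[L] (s + eichlerIntegral f τ) * G τ := by
        rw [zpow_neg]; field_simp
      rw [← this, h]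
    exact mul_right_cancel₀ hG h'
  -- a good point: `G ≠ 0`, `U ∉ Λ`, `s + U ∉ Λ`
  set O : Set ℂ := {z : ℂ | 0 < z.im ∧ (Gc z ≠ 0 ∧ s + U z ∉ L.lattice)} with hO
  have hOopen : IsOpen O := by
    have h1 : IsOpen {z : ℂ | 0 < z.im ∧ Gc z ∈ ({0} : Set ℂ)ᶜ} :=
      hGc'.isOpen_inter_preimage isOpen_upperHalfPlaneSet isOpen_compl_singleton
    have h2 : IsOpen {z : ℂ | 0 < z.im ∧ s + U z ∈ (L.lattice : Set ℂ)ᶜ} :=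
      (continuousOn_const.add hUc).isOpen_inter_preimage isOpen_upperHalfPlaneSet L.isClosed_lattice.isOpen_compl
    have : O = {z : ℂ | 0 < z.im ∧ Gc z ∈ ({0} : Set ℂ)ᶜ} ∩ {z : ℂ | 0 < z.im ∧ s + U z ∈ (L.lattice : Set ℂ)ᶜ} := by
      ext z
      simp only [hO, mem_setOf_eq, mem_inter_iff, mem_compl_iff, mem_singleton_iff, SetLike.mem_coe]
      tauto
    rw [this]
    exact h1.inter h2
  have hOne : O.Nonempty := by
    obtain ⟨τ₁, hτ₁⟩ := hG1
    by_contra hne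
    rw [not_nonempty_iff_eq_empty] at hne
    have hz₁ : 0 < (τ₁ : ℂ).im := τ₁.im_pos
    have hG₁ : Gc τ₁ ≠ 0 := by simpa [hGc, ofComplex_apply] using hτ₁
    have e1 : ∀ᶠ w in 𝓝 (τ₁ : ℂ), Gc w ≠ 0 :=
      (hGc'.continuousAt (isOpen_upperHalfPlaneSet.mem_nhds hz₁)).eventually_ne hG₁
    have e2 : ∀ᶠ w in 𝓝 (τ₁ : ℂ), s + U w ∈ ((L.lattice : Set ℂ) \ {s + U τ₁})ᶜ :=
      ((continuousOn_const.add hUc).continuousAt (isOpen_upperHalfPlaneSet.mem_nhds hz₁)).preimage_mem_nhds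
        (L.compl_lattice_sdiff_singleton_mem_nhds (s + U τ₁))
    have e0 : ∀ᶠ w in 𝓝 (τ₁ : ℂ), 0 < w.im := isOpen_upperHalfPlaneSet.mem_nhds hz₁
    apply not_eventually_const_eichlerIntegral f hf hz₁ (U τ₁)
    filter_upwards [e0, e1, e2] with w hw0 hw1 hw2
    have hwO : w ∉ O := by rw [hne]; exact Set.notMem_empty w
    have hmem : s + U w ∈ L.lattice := by
      by_contra hnot
      exact hwO ⟨hw0, hw1, hnot⟩
    have : s + U w = s + U τ₁ := by
      by_contra hne'
      exact hw2 ⟨hmem, hne'⟩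
    simpa using this
  obtain ⟨z₀, hz₀O, hz₀T⟩ : (O \ {z : ℂ | 0 < z.im ∧ U z ∈ L.lattice}).Nonempty := by
    by_contra hne
    rw [not_nonempty_iff_eq_empty, sdiff_eq_empty] at hne
    exact not_countable_of_isOpen hOopen hOne ((countable_setOf_eichlerIntegral_mem_lattice f L hf).mono hne)
  have hz₀ : 0 < z₀.im := hz₀O.1
  have hz₀L : U z₀ ∉ L.lattice := fun h ↦ hz₀T ⟨hz₀, h⟩
  have hev : ∀ᶠ z in 𝓝 z₀, ℘[L] (s + U z) = ℘[L] (U z) := by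
    filter_upwards [hOopen.mem_nhds hz₀O,
      (isOpen_setOf_eichlerIntegral_notMem_lattice f L).mem_nhds ⟨hz₀, hz₀L⟩] with z hzO hzL
    have hG : G (ofComplex z) ≠ 0 := by simpa [hGc] using hzO.2.1
    exact hpt (ofComplex z) hzL.2 hzO.2.2 hG
  exact L.mem_lattice_of_weierstrassP_comp_add_eventuallyEq (analyticAt_eichlerIntegral_comp_ofComplex f hz₀)
    (not_eventually_const_eichlerIntegral f hf hz₀ (U z₀)) hz₀L hz₀O.2.2 hev

/-- **(N5) `CDivStabiliser`.** [cite: Manin1972, Prop. 1.4] -/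
theorem cDivStabiliser_holds :
    ∀ (W : WeierstrassCurve ℚ) [W.IsElliptic] [W.IsGloballyMinimal] {N : ℕ} [NeZero N] (D : ModularParametrizationData W N)
      (w : ℤ) (Bd : ModularForm (Gamma0 N) w), Bd ≠ 0 → ∀ (a : ℕ) (F : ℍ → ℂ), MDifferentiable 𝓘(ℂ) 𝓘(ℂ) F →
    (∀ τ : ℍ, eichlerIntegral D.f τ ∉ D.L.lattice →
      F τ = ℘[D.L] (eichlerIntegral D.f τ) * ((12 : ℂ) * Bd τ * ModularForm.discriminant τ ^ a)) →
    ∀ γ : Gamma0 N, F ∣[w + 12 * (a : ℤ)] (γ : SL(2, ℤ)) = F → cuspSymbol D.f γ ∈ D.L.lattice := by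
  intro W _ _ N _ D w Bd hBd a F hF hFeq γ hγ
  have hf : D.f ≠ 0 := D.isNewformOf.1.ne_zero
  set G : ℍ → ℂ := fun τ ↦ (12 : ℂ) * Bd τ * ModularForm.discriminant τ ^ a with hG
  have hGmd : MDifferentiable 𝓘(ℂ) 𝓘(ℂ) G :=
    UpperHalfPlane.mdifferentiable_iff.mpr (analyticOnNhd_twelve_mul_mul_discriminant_pow' Bd.holo' a).differentiableOn
  have hG1 : ∃ τ₁ : ℍ, G τ₁ ≠ 0 := by
    obtain ⟨τ₁, hτ₁⟩ := DFunLike.ne_iff.mp hBd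
    refine ⟨τ₁, mul_ne_zero (mul_ne_zero (by norm_num) ?_) (pow_ne_zero _ (ModularForm.discriminant_ne_zero τ₁))⟩
    simpa using hτ₁
  have hGsmul : ∀ τ : ℍ, G ((γ : SL(2, ℤ)) • τ) = denom (γ : SL(2, ℤ)) τ ^ (w + 12 * (a : ℤ)) * G τ := by
    intro τ
    have hd0 : denom (γ : SL(2, ℤ)) τ ≠ 0 := denom_ne_zero (γ : SL(2, ℤ)) τ
    simp only [hG]
    rw [SlashInvariantForm.slash_action_eqn_SL'' Bd γ.2 τ, discriminant_apply_smul (γ : SL(2, ℤ)) τ, mul_pow,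
      ← zpow_natCast (denom (γ : SL(2, ℤ)) τ ^ (12 : ℤ)) a, ← zpow_mul, zpow_add₀ hd0]
    ring
  exact cuspSymbol_mem_of_slash_eq_zpow D.f hf D.L G F (w + 12 * (a : ℤ)) hGmd hG1 γ hGsmul
    (fun τ hτ ↦ (hFeq τ hτ).symm) hγ

end Summit.BirchSwinnertonDyer.BirchSwinnertonDyer.Theorems.ManinLocalTwoThree.CDivision

end
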